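import Summits.QuantumFields.BalabanUV.T4Continuum.Support.NE3CovariantTentInterpolant
import Summits.QuantumFields.BalabanUV.T4Continuum.Support.NE3DressedBlockField
import Summits.QuantumFields.BalabanUV.T4Continuum.Support.NE3TentBump
import HarnessLib

/-!
# T⁴ programme, node NE3 — row E-MLw-(w4)-P-curved, route H♮, row K5c (file 3): THE COVARIANT TENT INTERPOLANT WITH EXACT
# TRANSPORTED BLOCK MEANS — the dressed-bump correction, its exact corners∕means, and the energy of the correction

NE3 (node U1b) formalisation swarm, leaf seat `b2b-balaban-t4-ne3-formalise-leaf-01` (gen 6); row **K5** of ruling ρ-g22-2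
(`HOME/t4/b2b-balaban-t4-ne3-p1/g22/D-ne3p1-g22-1.md` §2 S6∕S7: the competitor must match the CORNER VALUES and the TRANSPORTED BLOCK
MEANS `bmeanW` (r1: tree words from the block corner) so that its difference to `ζ′` lies in `Ξ₀₀(W)`), sub-row **K5c** (FINDING
F-ne3leaf01g6-1 ∕ INTENT, `HOME/CLAIMS.log` 2026-08-20 ≈18:08Z ∕ ≈18:15Z).  Over file 1 `NE3CovariantTentInterpolant` (`tinterpW`: exact
corners), the lineage's K5b-1 `NE3DressedBlockField` (`dressW`, `bmeanW_dressW`, the in-block comb bound) and K5a `NE3TentBump` (`bump`,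
`sum_block_bump`, `tent ≤ 1∕M` on the last slice) BY NAME.

THE OBJECT.  Two coarse data: corner values `m` and block means `b`.  The mean-correction coefficient
`tmeanCoef M W m b z := (tentSum d M)⁻¹ • (M^d • (b z − bmeanW M W (tinterpW M W m) z))` and the corrected interpolant
**`tinterpMeanW M W m b y := tinterpW M W m y + dressW M W (bump M (tmeanCoef M W m b)) y`** (the bump of block `z`, dressed by the block
tree — the bump VANISHES on every face, so the dressing's face ribbons never act).  CONTENT ([folklore]; 0 sorry; DATA defs `tmeanCoef`,
`tinterpMeanW`):
§1 `bmeanW_add'` (additivity), **`tinterpMeanW_corner`** (`= m z` at `M•z`, `M ≥ 1`, `d ≥ 1`), **`bmeanW_tinterpMeanW`**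
   (`bmeanW M W (tinterpMeanW M W m b) z = b z` EXACTLY, `M ≥ 2`), `tinterpMeanW_mem_skewAdjoint`, **`tinterpMeanW_add_period`**;
§2 THE ENERGY OF A DRESSED BUMP (generic coefficient `c`, small field, `[Nonempty n]`): on EVERY fine bond of block `z`
   **`norm_gaugeDir_dressW_bump_le`** `‖gaugeDir W (dressW M W (bump M c)) (M•z + v) α‖ ≤ (1∕M + 2(d−1)(M−1)a)·‖c z‖` (in-block: K5b-1's
   comb bound + `‖dPot bump‖ ≤ ‖c‖∕M`; face: the arriving bump is `0`, the departing tent `≤ 1∕M`), and summed over one period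
   **`sum_normSq_gaugeDir_dressW_bump_le`** `≤ d·M^d·(1∕M + 2(d−1)(M−1)a)²·Σ_{z∈periodBox N} ‖c z‖²` — `M^{d−2}·(1 + (2(d−1)(M−1)M·a)²)`-sized,
   the S7 shape (`M²a ≤ b∕L²`); §3 **`norm_tmeanCoef_le`** `‖tmeanCoef … z‖ ≤ 8^d·‖b z − bmeanW M W (tinterpW M W m) z‖` (`M ≥ 2`).
   (The interpolation-mean defect `‖m z − bmeanW (tinterpW m) z‖` against covariant cube differences + transport defects: sequel.)

HONEST FRAMING.  Kinematics of OUR competitor at one background in the small-field class; nothing about Bałaban's minimisers;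
(P♮)_W ∕ (ML_w) at W ≠ 1, T-E_w and **NE3 are NOT proved**; spine PROVED 0∕9; finite T⁴ rung (B)+1 — NOT infinite volume, NOT
mass gap, NOT `BetaPertH`, NOT Clay.  PLACEMENT: `Summits/QuantumFields/BalabanUV/`.  HONEST DEPENDENCY (cell page 1): continuum YM
on T⁴ ⇐ BetaPertH ∧ nine spine estimates (0/9 proved); BetaPertH ⇐ (D1) ∧ (D4) ∧ CAP+tail; G-an2-4 gates asym, D1 and NE2/3/4.
-/

set_option autoImplicit false

open scoped BigOperators Matrix.Norms.L2Operator
open Finset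

namespace Summit.QuantumFields.BalabanUV.T4Continuum.NE3CovariantTentInterpolantMean

open Literature.MathematicalPhysics.QuantumFieldTheory.Balaban1983to89
open B7Prop1Explicit B7Prop2Explicit
open T4AveragingDeficitWall (IsUnitaryCfg SmallField Ad)
open T4AveragingDeficitWallBoundary (periodBox mem_periodBox card_periodBox IsPeriodicCfg)
open AveragingDeficitTransport (Ad_mem_skewAdjoint norm_Ad_of_unitary)
open AveragingDeficitNearIdentity (Ad_add)
open AveragingDeficitBlockDensity (btree btree_mem)
open BlockAveragePushDirGauge (gaugeDir)
open SmoothRefineBlocks (blk res blk_res_eq_of res_add_e_self)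
open NE3CoarseInterpolant (blk_block)
open NE3BlockLineAverage (sum_periodBox_blocks)
open NE3TangentNoGoWords (dPot)
open NE3TentBump (tent tentSum tentSum_pos le_tentSum tent_nonneg tent_le_one tent_le_inv_of_res_eq bump bump_corner
  bump_of_res_eq_zero sum_block_bump bump_add_period norm_dPot_bump_le)
open NE3CovariantBlockMean (bmeanW bmeanW_mem_skewAdjoint bmeanW_add_period)
open NE3DressedBlockField (dressW dressW_corner dressW_mem_skewAdjoint dressW_add_period bmeanW_dressW cdiv_block
  norm_gaugeDir_dressW_inblock_le)
open NE3CovariantTentInterpolant (tinterpW tinterpW_corner tinterpW_mem_skewAdjoint tinterpW_add_period)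

noncomputable section

variable {d : ℕ} {n : Type*} [Fintype n] [DecidableEq n]

/-! ## §1 The mean-corrected interpolant: exact corners and exact transported block means -/

/-- THE MEAN-CORRECTION COEFFICIENT of block `z`: `(tentSum d M)⁻¹ • (M^d • (b z − bmeanW M W (tinterpW M W m) z))`. [folklore] -/
def tmeanCoef (M : ℕ) (W : Site d → Fin d → (Matrix n n ℂ)ˣ) (m b : Site d → Matrix n n ℂ) (z : Site d) : Matrix n n ℂ :=
  (tentSum d M)⁻¹ • (((M : ℝ) ^ d) • (b z - bmeanW M W (tinterpW M W m) z))

/-- **THE MEAN-CORRECTED COVARIANT TENT INTERPOLANT**: `tinterpW` plus the dressed tent bump carrying the mean correction. [folklore] -/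
def tinterpMeanW (M : ℕ) (W : Site d → Fin d → (Matrix n n ℂ)ˣ) (m b : Site d → Matrix n n ℂ) (y : Site d) : Matrix n n ℂ :=
  tinterpW M W m y + dressW M W (bump M (tmeanCoef M W m b)) y

/-- `bmeanW` is additive in the field (pointwise form). [folklore] -/
theorem bmeanW_add' (M : ℕ) (W : Site d → Fin d → (Matrix n n ℂ)ˣ) (A B : Site d → Matrix n n ℂ) (z : Site d) :
    bmeanW M W (fun y => A y + B y) z = bmeanW M W A z + bmeanW M W B z := by
  simp only [bmeanW, Ad_add, smul_add, Finset.sum_add_distrib]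

/-- **CORNER VALUES**: `tinterpMeanW M W m b (M•z) = m z` (`M ≥ 1`, `d ≥ 1`: the bump vanishes at the corners). [folklore] -/
theorem tinterpMeanW_corner {M : ℕ} (hM : 1 ≤ M) (hd : 0 < d) (W : Site d → Fin d → (Matrix n n ℂ)ˣ) (m b : Site d → Matrix n n ℂ)
    (z : Site d) : tinterpMeanW M W m b ((M : ℤ) • z) = m z := by
  unfold tinterpMeanW
  rw [tinterpW_corner hM, dressW_corner hM, bump_corner hM hd, add_zero]

/-- **EXACT TRANSPORTED BLOCK MEANS**: `bmeanW M W (tinterpMeanW M W m b) z = b z` (`M ≥ 2`). [folklore] -/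
theorem bmeanW_tinterpMeanW {M : ℕ} (hM : 2 ≤ M) (W : Site d → Fin d → (Matrix n n ℂ)ˣ) (m b : Site d → Matrix n n ℂ) (z : Site d) :
    bmeanW M W (tinterpMeanW M W m b) z = b z := by
  have hM1 : 1 ≤ M := by omega
  have hM0 : ((M : ℝ) ^ d) ≠ 0 := by
    have : (0 : ℝ) < M := by exact_mod_cast (by omega : 0 < M)
    positivity
  have hT : tentSum d M ≠ 0 := (tentSum_pos hM d).ne'
  have h1 : bmeanW M W (tinterpMeanW M W m b) z
      = bmeanW M W (tinterpW M W m) z + bmeanW M W (dressW M W (bump M (tmeanCoef M W m b))) z :=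
    bmeanW_add' M W _ _ z
  rw [h1, bmeanW_dressW, sum_block_bump hM1, tmeanCoef, smul_smul, smul_smul, smul_smul]
  have hc : ((M : ℝ) ^ d)⁻¹ * tentSum d M * (tentSum d M)⁻¹ * (M : ℝ) ^ d = 1 := by
    field_simp
  rw [hc, one_smul, add_sub_cancel]

/-- The mean-correction coefficient of 𝔲(n)-valued data at a unitary background is 𝔲(n)-valued. [folklore] -/
theorem tmeanCoef_mem_skewAdjoint (M : ℕ) {W : Site d → Fin d → (Matrix n n ℂ)ˣ} (hW : IsUnitaryCfg W) {m b : Site d → Matrix n n ℂ}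
    (hm : ∀ w, m w ∈ skewAdjoint (Matrix n n ℂ)) (hb : ∀ w, b w ∈ skewAdjoint (Matrix n n ℂ)) (z : Site d) :
    tmeanCoef M W m b z ∈ skewAdjoint (Matrix n n ℂ) := by
  unfold tmeanCoef
  refine skewAdjoint.smul_mem _ (skewAdjoint.smul_mem _ ((skewAdjoint (Matrix n n ℂ)).sub_mem (hb z) ?_))
  exact bmeanW_mem_skewAdjoint M hW (fun x => tinterpW_mem_skewAdjoint M hW hm x) z

/-- **`tinterpMeanW` IS 𝔲(n)-VALUED** for 𝔲(n)-valued data at a unitary background. [folklore] -/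
theorem tinterpMeanW_mem_skewAdjoint (M : ℕ) {W : Site d → Fin d → (Matrix n n ℂ)ˣ} (hW : IsUnitaryCfg W) {m b : Site d → Matrix n n ℂ}
    (hm : ∀ w, m w ∈ skewAdjoint (Matrix n n ℂ)) (hb : ∀ w, b w ∈ skewAdjoint (Matrix n n ℂ)) (y : Site d) :
    tinterpMeanW M W m b y ∈ skewAdjoint (Matrix n n ℂ) := by
  unfold tinterpMeanW
  refine (skewAdjoint (Matrix n n ℂ)).add_mem (tinterpW_mem_skewAdjoint M hW hm y) (dressW_mem_skewAdjoint M hW ?_ y)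
  intro x
  unfold bump
  exact skewAdjoint.smul_mem _ (tmeanCoef_mem_skewAdjoint M hW hm hb _)

/-- Periodicity of the coefficient: `N`-periodic data at an `(M·N)`-periodic background (`M ≥ 1`). [folklore] -/
theorem tmeanCoef_add_period {M : ℕ} (hM : 1 ≤ M) {N : ℕ} {W : Site d → Fin d → (Matrix n n ℂ)ˣ}
    (hWP : IsPeriodicCfg W ((M : ℤ) * N)) {m b : Site d → Matrix n n ℂ}
    (hm : ∀ (z : Site d) (τ : Fin d), m (z + (N : ℤ) • e τ) = m z) (hb : ∀ (z : Site d) (τ : Fin d), b (z + (N : ℤ) • e τ) = b z)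
    (z : Site d) (τ : Fin d) : tmeanCoef M W m b (z + (N : ℤ) • e τ) = tmeanCoef M W m b z := by
  unfold tmeanCoef
  have hP : ∀ (x : Site d) (i : Fin d), tinterpW M W m (x + ((M : ℤ) * (N : ℤ)) • e i) = tinterpW M W m x := by
    intro x i
    have h := tinterpW_add_period hM hWP hm x i
    have hc : ((M * N : ℕ) : ℤ) = (M : ℤ) * (N : ℤ) := by push_cast; ring
    rwa [hc] at h
  rw [hb, bmeanW_add_period M (P := (N : ℤ)) hWP hP]

/-- **PERIODICITY**: `(M·N)`-periodic `W`, `N`-periodic `m`, `b` give an `(M·N)`-periodic corrected interpolant (`M ≥ 1`). [folklore] -/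
theorem tinterpMeanW_add_period {M : ℕ} (hM : 1 ≤ M) {N : ℕ} {W : Site d → Fin d → (Matrix n n ℂ)ˣ}
    (hWP : IsPeriodicCfg W ((M : ℤ) * N)) {m b : Site d → Matrix n n ℂ}
    (hm : ∀ (z : Site d) (τ : Fin d), m (z + (N : ℤ) • e τ) = m z) (hb : ∀ (z : Site d) (τ : Fin d), b (z + (N : ℤ) • e τ) = b z)
    (y : Site d) (τ : Fin d) :
    tinterpMeanW M W m b (y + ((M * N : ℕ) : ℤ) • e τ) = tinterpMeanW M W m b y := by
  unfold tinterpMeanW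
  have hc : ((M * N : ℕ) : ℤ) = (M : ℤ) * (N : ℤ) := by push_cast; ring
  have hbump : ∀ (x : Site d) (i : Fin d),
      bump M (tmeanCoef M W m b) (x + ((M : ℤ) * N) • e i) = bump M (tmeanCoef M W m b) x := by
    intro x i
    have h := bump_add_period hM (tmeanCoef_add_period hM hWP hm hb) x i
    rwa [hc] at h
  rw [tinterpW_add_period hM hWP hm, hc, dressW_add_period hM hWP hbump]

/-! ## §2 The energy of a dressed bump -/

section Small

variable [Nonempty n]

/-- **A DRESSED BUMP, BOND BY BOND** (`M ≥ 1`, `W` unitary, `SmallField W a`, `0 ≤ a`): for every bond `(M•z + v, α)`, `v ∈ [0,M)^d`,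
`‖gaugeDir W (dressW M W (bump M c)) (M•z + v) α‖ ≤ (1∕M + 2·(d−1)(M−1)·a)·‖c z‖` — in the block the tent moves by `≤ 1∕M` and the
comb loop acts on the value (K5b-1); across the far face the arriving bump is `0` and the departing tent is `≤ 1∕M`. [folklore] -/
theorem norm_gaugeDir_dressW_bump_le {M : ℕ} (hM : 1 ≤ M) {W : Site d → Fin d → (Matrix n n ℂ)ˣ} (hW : IsUnitaryCfg W)
    {a : ℝ} (ha : 0 ≤ a) (hWa : SmallField W a) (c : Site d → Matrix n n ℂ) (z : Site d) {v : Site d}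
    (hv : v ∈ periodBox (d := d) M) (α : Fin d) :
    ‖gaugeDir W (dressW M W (bump M c)) ((M : ℤ) • z + v) α‖
      ≤ (1 / (M : ℝ) + 2 * (((d : ℝ) - 1) * ((M : ℝ) - 1) * a)) * ‖c z‖ := by
  have hM0 : (0 : ℝ) < M := by exact_mod_cast (by omega : 0 < M)
  have hd1 : (1 : ℝ) ≤ d := by exact_mod_cast Fin.pos α
  have hM1 : (1 : ℝ) ≤ M := by exact_mod_cast hM
  have hK0 : 0 ≤ ((d : ℝ) - 1) * ((M : ℝ) - 1) * a := mul_nonneg (mul_nonneg (by linarith) (by linarith)) ha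
  set y : Site d := (M : ℤ) • z + v with hy
  have hvi := fun i => (mem_periodBox.1 hv i)
  obtain ⟨hblk, hres⟩ := blk_res_eq_of (L := M) hM hy.symm (fun i => (hvi i).1) (fun i => (hvi i).2)
  have hcd : SkeletonLattice.cdiv M y = z := by rw [hy]; exact cdiv_block z hv
  have hbumpy : ‖bump M c y‖ = tent M y * ‖c z‖ := by
    unfold bump; rw [norm_smul, Real.norm_of_nonneg (tent_nonneg hM y), hblk]
  by_cases hface : v α = (M : ℤ) - 1
  · -- the far face: the bump at `y + e α` vanishes, the tent at `y` is `≤ 1/M`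
    have hry : res M y α = (M : ℤ) - 1 := by rw [hres]; exact hface
    have hr0 : res M (y + e α) α = 0 := by rw [res_add_e_self hM, if_pos hry]
    have hzero : bump M c (y + e α) = 0 := bump_of_res_eq_zero M c hr0
    have hgd : gaugeDir W (dressW M W (bump M c)) y α = Ad (W y α)⁻¹ (dressW M W (bump M c) y) := by
      simp only [gaugeDir, dressW, hzero, AveragingDeficitNearIdentity.Ad_zero, sub_zero]
    rw [hgd, norm_Ad_of_unitary ((unitaryUnits _).inv_mem (hW y α)), dressW,
      norm_Ad_of_unitary ((unitaryUnits _).inv_mem (btree_mem hW M _ _)), hbumpy]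
    have ht := tent_le_inv_of_res_eq hM hry
    calc tent M y * ‖c z‖ ≤ (1 / (M : ℝ)) * ‖c z‖ := mul_le_mul_of_nonneg_right ht (norm_nonneg _)
      _ ≤ (1 / (M : ℝ) + 2 * (((d : ℝ) - 1) * ((M : ℝ) - 1) * a)) * ‖c z‖ := by
          refine mul_le_mul_of_nonneg_right ?_ (norm_nonneg _); linarith
  · -- inside the block: both ends in block `z`
    have hvα : v α + 1 < M := by
      have := (hvi α).2; omega
    have hv' : v + e α ∈ periodBox (d := d) M := by
      rw [mem_periodBox]; intro i
      by_cases hi : i = α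
      · subst hi; simp only [Pi.add_apply, B8Lemma1NonAbelian.e_apply_self]; exact ⟨by linarith [(hvi i).1], hvα⟩
      · simp only [Pi.add_apply, B8Lemma1NonAbelian.e_apply_of_ne hi, add_zero]; exact hvi i
    have hcd' : SkeletonLattice.cdiv M (y + e α) = SkeletonLattice.cdiv M y := by
      rw [hcd, hy, add_assoc]; exact cdiv_block z hv'
    refine (norm_gaugeDir_dressW_inblock_le hM hW ha hWa (bump M c) hcd').trans ?_
    have h1 := norm_dPot_bump_le hM c y α
    rw [hblk] at h1
    rw [hbumpy, add_mul]
    refine add_le_add h1 ?_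
    have ht1 := tent_le_one hM y
    have ht0 := tent_nonneg hM y
    calc 2 * (((d : ℝ) - 1) * ((M : ℝ) - 1) * a) * (tent M y * ‖c z‖)
        ≤ 2 * (((d : ℝ) - 1) * ((M : ℝ) - 1) * a) * (1 * ‖c z‖) := by gcongr
      _ = 2 * (((d : ℝ) - 1) * ((M : ℝ) - 1) * a) * ‖c z‖ := by rw [one_mul]

/-- **THE ENERGY OF A DRESSED BUMP OVER ONE PERIOD** (`M ≥ 1`, any `N`):
`Σ_{y∈periodBox(M·N)} Σ_α ‖gaugeDir W (dressW M W (bump M c)) y α‖² ≤ d·M^d·(1∕M + 2(d−1)(M−1)a)²·Σ_{z∈periodBox N} ‖c z‖²`. [folklore] -/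
theorem sum_normSq_gaugeDir_dressW_bump_le {M : ℕ} (hM : 1 ≤ M) (N : ℕ) {W : Site d → Fin d → (Matrix n n ℂ)ˣ}
    (hW : IsUnitaryCfg W) {a : ℝ} (ha : 0 ≤ a) (hWa : SmallField W a) (c : Site d → Matrix n n ℂ) :
    ∑ y ∈ periodBox (d := d) (M * N), ∑ α : Fin d, ‖gaugeDir W (dressW M W (bump M c)) y α‖ ^ 2
      ≤ (d : ℝ) * (M : ℝ) ^ d * (1 / (M : ℝ) + 2 * (((d : ℝ) - 1) * ((M : ℝ) - 1) * a)) ^ 2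
          * ∑ z ∈ periodBox (d := d) N, ‖c z‖ ^ 2 := by
  rw [← sum_periodBox_blocks M N hM, Finset.mul_sum]
  refine Finset.sum_le_sum fun z _ => ?_
  calc ∑ v ∈ periodBox (d := d) M, ∑ α : Fin d, ‖gaugeDir W (dressW M W (bump M c)) ((M : ℤ) • z + v) α‖ ^ 2
      ≤ ∑ v ∈ periodBox (d := d) M, ∑ _α : Fin d, ((1 / (M : ℝ) + 2 * (((d : ℝ) - 1) * ((M : ℝ) - 1) * a)) * ‖c z‖) ^ 2 := by
        refine Finset.sum_le_sum fun v hv => Finset.sum_le_sum fun α _ => ?_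
        exact pow_le_pow_left₀ (norm_nonneg _) (norm_gaugeDir_dressW_bump_le hM hW ha hWa c z hv α) 2
    _ = (d : ℝ) * (M : ℝ) ^ d * (1 / (M : ℝ) + 2 * (((d : ℝ) - 1) * ((M : ℝ) - 1) * a)) ^ 2 * ‖c z‖ ^ 2 := by
        rw [Finset.sum_const, Finset.sum_const, Finset.card_univ, Fintype.card_fin, card_periodBox, nsmul_eq_mul, nsmul_eq_mul]
        push_cast; ring

end Small

/-! ## §3 The size of the mean-correction coefficient -/

/-- **`‖tmeanCoef M W m b z‖ ≤ 8^d · ‖b z − bmeanW M W (tinterpW M W m) z‖`** (`M ≥ 2`: `tentSum ≥ (M∕8)^d`). [folklore] -/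
theorem norm_tmeanCoef_le {M : ℕ} (hM : 2 ≤ M) (W : Site d → Fin d → (Matrix n n ℂ)ˣ) (m b : Site d → Matrix n n ℂ) (z : Site d) :
    ‖tmeanCoef M W m b z‖ ≤ (8 : ℝ) ^ d * ‖b z - bmeanW M W (tinterpW M W m) z‖ := by
  have hM0 : (0 : ℝ) < M := by exact_mod_cast (by omega : 0 < M)
  have hTS := tentSum_pos hM d
  have hTSle := le_tentSum hM d
  unfold tmeanCoef
  rw [norm_smul, norm_smul, Real.norm_of_nonneg (inv_nonneg.mpr hTS.le), Real.norm_of_nonneg (by positivity), ← mul_assoc]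
  refine mul_le_mul_of_nonneg_right ?_ (norm_nonneg _)
  rw [inv_mul_le_iff₀ hTS]
  calc (M : ℝ) ^ d = ((M : ℝ) / 8) ^ d * (8 : ℝ) ^ d := by rw [← mul_pow]; congr 1; ring
    _ ≤ tentSum d M * (8 : ℝ) ^ d := mul_le_mul_of_nonneg_right hTSle (by positivity)

end

end Summit.QuantumFields.BalabanUV.T4Continuum.NE3CovariantTentInterpolantMean
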